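import Mathlib
import Summits.KontsevichZagierPeriods.Zeta5Search.TSOriginDataO54A
import HarnessLib

/-!
# ζ(5) search — data of gen-2 g13's ORIGIN type-space window `M = 54` (`16 * n < 17 * p`,
    `18 * p ≤ 17 * n`) (part 5/8) (HONEST FRAMING: systematic search; no irrationality claim unless certified)

Cell `pub-zeta5`, prover seat p3 generation 3 (generated by `code/gen/tsdata.py`).  Inventory of the window (all odd `p`, `n ≤ 150`,
    `code/gen/tswin.py`):
deep types `D54` (3), centre-free sub-deep types `S54` (4), odd-centre types `P54` (1); ALL type-level doubled orbit points lie on ONE line: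
primitive direction `u54 = (38222630941052634846231007929863313589916160000, -57993101249962008127812740936483643927138591089)`,
    `Φ_u = u₁V − u₂W = c54 = 244175701002234614009310255431014105282728794809801842371/6290677286972128380019802112000000`; every deep orbit vector is `∥ u54`.  Each identity is PROVED by the computable
mirror `TypeEval.typeRho_eq_typeRhoC` + `decide +kernel`; `lineData54 : LineData u54 c54 D54 S54 P54` feeds `OriginWindows.deep_dir/lineVal_live`
in the machine file `TSWindowO54.lean` (`ResidueLaw.RecTSClassesO54`, `RecWindowTSM54`).  Rational bookkeeping; nothing here bears on irrationality.
-/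

noncomputable section

open Finset

namespace Summit.KontsevichZagierPeriods.Zeta5Search.OriginWindows

open Summit.KontsevichZagierPeriods.Zeta5Search.SecondOrder
open Summit.KontsevichZagierPeriods.Zeta5Search.LevelClass (typeW typeV)
open Summit.KontsevichZagierPeriods.Zeta5Search.ZeroWindows (deepPoint pairPoint)
open Summit.KontsevichZagierPeriods.Zeta5Search.TypeEval (typeRho_eq_typeRhoC)

variable {p : ℕ} [hp : Fact p.Prime]

set_option maxHeartbeats 16000000 in
/-- Line datum (`M = 54`): sub-deep type 1, pair point on the line. -/
theorem s54_pt_1 : lineVal u54 (pairPoint [1, 1, 1, 1, 1, 1, 1, 1, 1, 1, 1, 1, 0, -1, -2, -3, -4, -5, -5, -6, -6, -6, -6, -6, -6, -6, -5, -4, -3, -2,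
    -1, 0, 1, 1, 1, 1, 1, 1, 1, 1, 1, 1, 1, 1]) = c54 := by
  unfold lineVal ZeroWindows.pairPoint LevelClass.typeW LevelClass.typeV; simp only [typeRho_eq_typeRhoC]; decide +kernel

set_option maxHeartbeats 16000000 in
/-- Line datum (`M = 54`): sub-deep type 2, pair point on the line. -/
theorem s54_pt_2 : lineVal u54 (pairPoint [1, 1, 1, 1, 1, 1, 1, 1, 1, 1, 1, 1, 0, -1, -2, -3, -4, -5, -6, -6, -6, -6, -6, -6, -6, -5, -5, -4, -3, -2,
    -1, 0, 1, 1, 1, 1, 1, 1, 1, 1, 1, 1, 1, 1]) = c54 := by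
  unfold lineVal ZeroWindows.pairPoint LevelClass.typeW LevelClass.typeV; simp only [typeRho_eq_typeRhoC]; decide +kernel

end Summit.KontsevichZagierPeriods.Zeta5Search.OriginWindows

end
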